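import Summits.ValiantsHypothesis.ValiantsHypothesis.Theorems.SymPencilConeKernelCodim
import Summits.ValiantsHypothesis.ValiantsHypothesis.Theorems.SymPencilSdcPerSq

/-!
# Route `SymPencil` — the kernel-row map of a symmetric pencil for `per_n` is injective at every
# nondegenerate zero whenever the size is `≤ 2n² - 4` (structural rung toward `SdcSuperquadratic`,
# stmt-ValiantsHypothesis-5674)

Let `A = A₀ + Σ_v X_v A_v` be a SYMMETRIC affine determinantal representation of `per_n`, `n ≥ 3`,
of size `m`, over a field of characteristic `0` (so `n² + 1 ≤ m`, `SymPencilSdcPerBeyondN`).  At a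
zero `x ≠ 0` of `per_n` with nondegenerate Hessian (e.g. the Mignon–Ressayre point `y₀` and its
whole cone line), `A(x)` has corank exactly `1` (von zur Gathen / Alper–Bogart–Velasco regularity)
with kernel vector `w`, and the KERNEL-ROW MAP `Φ_x : y ↦ M(y) w = (Σ_v y_v A_v) w ∈ K^m` has rank
`≥ n² - 1` (`SymPencilKernelRowRank`).  **Dichotomy** (`kernelRow_injective_of_le`): either
`2n² ≤ m + 3`, or `Φ_x` is INJECTIVE (rank `n²`) — because a kernel direction `d ≠ 0` of `Φ_x` is
forced onto the cone direction by the nondegenerate Hessian (Euler + Jacobi + two-sided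
vanishing), so `A₀ w = 0`, and then the homogeneity identity in the normal form `0 ⊕ Δ` gives
`rank A₀ ≤ 2 (m - n² + 1)` (`SymPencilConeKernelCodim.rank_constPart_add_le`), against
`rank A₀ = rank A(0) = m - 1` (regularity at the origin).

So in the whole range `n² + 1 ≤ m ≤ 2n² - 4` the only configuration left for the crux
`SdcSuperquadratic` is "Case II": at every nondegenerate zero the `n²` vectors `A_v w(x)` are
linearly independent (`linearIndependent_coeffMat_mulVec_of_le`), i.e. the fibre of the kernel map
`x ↦ [w(x)]` through `x` is the single point `x`.  This file records that reduction; it proves no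
new lower bound and does not bear on `VP ≠ VNP`. [folklore]
-/

noncomputable section

-- single-conjunct layout: Sub = Summit, duplicated namespace component intended
set_option linter.dupNamespace false

namespace Summit.ValiantsHypothesis.ValiantsHypothesis.Theorems.SymPencilKernelRowInjective

open Matrix MvPolynomial
open Literature.Computability.AlgebraicComplexity
open Summit.ValiantsHypothesis.ValiantsHypothesis.Theorems.SymPencilConeKernelCodim
open Summit.ValiantsHypothesis.ValiantsHypothesis.Theorems.SymPencilSdcPerSqPred
open Summit.ValiantsHypothesis.ValiantsHypothesis.Theorems.SymPencilSdcPerSq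

/-- **Kernel-row injectivity below `2n² - 3`.**  For a symmetric affine determinantal
representation `A` of `per_{m'+3}` of size `m` with `m + 4 ≤ 2 (m'+3)²` (characteristic `0`), a
zero `x ≠ 0` of the permanent with nondegenerate Hessian, and a kernel vector `w ≠ 0` of `A(x)`:
the kernel-row map `d ↦ (Σ_v d_v A_v) w` is injective. [folklore] -/
theorem kernelRow_injective_of_le (K : Type*) [Field K] [CharZero K] (m' : ℕ) {m : ℕ}
    {A : Matrix (Fin m) (Fin m) (MvPolynomial (Fin (m' + 3) × Fin (m' + 3)) K)}
    (hS : A.IsSymm) (hA : IsAffineDetRepr (perPoly (Fin (m' + 3)) K) A)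
    (hm : m + 4 ≤ 2 * (m' + 3) ^ 2) (x : Fin (m' + 3) × Fin (m' + 3) → K)
    (hx0 : x ≠ 0)
    (hHess : (hessianMatrix (perPoly (Fin (m' + 3)) K) x).rank = (m' + 3) ^ 2)
    (w : Fin m → K) (hw : w ≠ 0) (hwA : A.map (eval x) *ᵥ w = 0)
    (d : Fin (m' + 3) × Fin (m' + 3) → K) (hd : (∑ v, d v • LRPencil.coeffMat A v) *ᵥ w = 0) :
    d = 0 := by
  by_contra hd0
  have hhom : (perPoly (Fin (m' + 3)) K).IsHomogeneous (m' + 3) := by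
    simpa using (perPoly_isHomogeneous (n := Fin (m' + 3)) (k := K))
  have hsq := sq_le_of_isSymm_isAffineDetRepr_perPoly K m' hS hA
  have hHess' : (hessianMatrix (perPoly (Fin (m' + 3)) K) x).rank =
      Fintype.card (Fin (m' + 3) × Fin (m' + 3)) := by
    rw [hHess, Fintype.card_prod, Fintype.card_fin, sq]
  have hcork : Fintype.card (Fin m) ≤ (A.map (eval x)).rank + 1 := by
    rw [Fintype.card_fin]
    exact AlperBogartVelasco.le_rank_map_eval_add_one two_ne_zero (by omega) A hA.2 _
  have h := rank_constPart_add_le hhom (by omega) hS hA x hx0 hHess' hcork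
    (by rw [Fintype.card_fin]; nlinarith) w hw hwA d hd0 hd
  -- regularity at the origin: `rank A(0) ≥ m - 1`
  have hreg0 := AlperBogartVelasco.le_rank_map_eval_add_one two_ne_zero (by omega) A hA.2 0
  rw [← constPart_eq_map_eval_zero] at hreg0
  rw [Fintype.card_prod, Fintype.card_fin, Fintype.card_fin] at h
  nlinarith

/-- **The same at the Mignon–Ressayre point `y₀`** (where the Hessian of `per_{m'+3}` is
nondegenerate, `rank_hessianMatrix_perPoly_mrPoint`): for `m + 4 ≤ 2 (m'+3)²` the kernel-row map
of any symmetric affine determinantal representation of size `m` at `y₀` is injective.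
[folklore] -/
theorem kernelRow_injective_mrPoint_of_le (K : Type*) [Field K] [CharZero K] (m' : ℕ) {m : ℕ}
    {A : Matrix (Fin m) (Fin m) (MvPolynomial (Fin (m' + 3) × Fin (m' + 3)) K)}
    (hS : A.IsSymm) (hA : IsAffineDetRepr (perPoly (Fin (m' + 3)) K) A)
    (hm : m + 4 ≤ 2 * (m' + 3) ^ 2) (w : Fin m → K) (hw : w ≠ 0)
    (hwA : A.map (eval (mrPoint K m')) *ᵥ w = 0)
    (d : Fin (m' + 3) × Fin (m' + 3) → K) (hd : (∑ v, d v • LRPencil.coeffMat A v) *ᵥ w = 0) :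
    d = 0 := by
  have hx0 : mrPoint K m' ≠ 0 := by
    intro h
    have h1 := congr_fun h ((1 : Fin (m' + 3)), (1 : Fin (m' + 3)))
    simp [mrPoint] at h1
  exact kernelRow_injective_of_le K m' hS hA hm (mrPoint K m') hx0
    (rank_hessianMatrix_perPoly_mrPoint K m') w hw hwA d hd

/-- **Linear-independence form.**  Below `2n² - 3`, at a nondegenerate zero `x ≠ 0` with kernel
vector `w ≠ 0`, the `n²` vectors `A_v w` (`v ∈ [n] × [n]`) are linearly independent: the fibre of
the kernel map through `x` is `{x}`. [folklore] -/
theorem linearIndependent_coeffMat_mulVec_of_le (K : Type*) [Field K] [CharZero K] (m' : ℕ)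
    {m : ℕ} {A : Matrix (Fin m) (Fin m) (MvPolynomial (Fin (m' + 3) × Fin (m' + 3)) K)}
    (hS : A.IsSymm) (hA : IsAffineDetRepr (perPoly (Fin (m' + 3)) K) A)
    (hm : m + 4 ≤ 2 * (m' + 3) ^ 2) (x : Fin (m' + 3) × Fin (m' + 3) → K)
    (hx0 : x ≠ 0)
    (hHess : (hessianMatrix (perPoly (Fin (m' + 3)) K) x).rank = (m' + 3) ^ 2)
    (w : Fin m → K) (hw : w ≠ 0) (hwA : A.map (eval x) *ᵥ w = 0) :
    LinearIndependent K (fun v : Fin (m' + 3) × Fin (m' + 3) => LRPencil.coeffMat A v *ᵥ w) := by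
  rw [Fintype.linearIndependent_iff]
  intro d hd v
  have hsum : (∑ u, d u • LRPencil.coeffMat A u) *ᵥ w = ∑ u, d u • (LRPencil.coeffMat A u *ᵥ w) := by
    rw [Matrix.sum_mulVec]
    exact Finset.sum_congr rfl fun u _ => Matrix.smul_mulVec _ _ _
  have h := kernelRow_injective_of_le K m' hS hA hm x hx0 hHess w hw hwA d (by rw [hsum, hd])
  rw [h, Pi.zero_apply]

/-- **Dichotomy, packaged for general `n ≥ 3`.**  For every symmetric affine determinantal
representation of `per_n` (`n ≥ 3`) of size `m` over a field of characteristic `0`, and every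
zero `x ≠ 0` of `per_n` with nondegenerate Hessian and kernel vector `w ≠ 0` of `A(x)`:
either `2 n² ≤ m + 3`, or the kernel-row map at `x` is injective. [folklore] -/
theorem sq_le_or_kernelRow_injective (K : Type*) [Field K] [CharZero K] {n : ℕ} (hn : 3 ≤ n)
    {m : ℕ} {A : Matrix (Fin m) (Fin m) (MvPolynomial (Fin n × Fin n) K)} (hS : A.IsSymm)
    (hA : IsAffineDetRepr (perPoly (Fin n) K) A) (x : Fin n × Fin n → K) (hx0 : x ≠ 0)
    (hHess : (hessianMatrix (perPoly (Fin n) K) x).rank = n ^ 2) (w : Fin m → K) (hw : w ≠ 0)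
    (hwA : A.map (eval x) *ᵥ w = 0) :
    2 * n ^ 2 ≤ m + 3 ∨
      ∀ d : Fin n × Fin n → K, (∑ v, d v • LRPencil.coeffMat A v) *ᵥ w = 0 → d = 0 := by
  obtain ⟨m', rfl⟩ : ∃ m', n = m' + 3 := ⟨n - 3, by omega⟩
  by_cases hm : m + 4 ≤ 2 * (m' + 3) ^ 2
  · exact Or.inr fun d hd => kernelRow_injective_of_le K m' hS hA hm x hx0 hHess w hw hwA d hd
  · exact Or.inl (by omega)

end Summit.ValiantsHypothesis.ValiantsHypothesis.Theorems.SymPencilKernelRowInjective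

end
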